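import Summits.BirchSwinnertonDyer.BirchSwinnertonDyer.Theorems.EisensteinPrimesBSDpOnCellCOfCitedFactsR5
import Summits.BirchSwinnertonDyer.BirchSwinnertonDyer.Theorems.EisensteinPrimesBSDpOnCellCKolyvaginOfGZK
import HarnessLib

/-!
# [telescope v21 — LEAD cruxlead-19034 g9, 2026-08-30; CUMULATIVE closure of the K-lane and the CAS-lane] CRUX 4 `BSDpOnCellC` FROM 21 REFEREED FACTS (NO Kolyvagin Thm. A, NO Castella 2018 Thms. 2.10–2.11),
# Keller–Yin ×3, T-An-2ʳ and crux 3 — CONDITIONAL CLOSURE, SORRY-FREE (`--supports`, helper; the hostʼs «one later item» of STATUS l.7385 (2) / l.7401 (iii))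

Crux 4 `BSDpOnCellC` (stmt-BirchSwinnertonDyer-19034), line «telescope» v21. WHAT: `bsdpOnCellC_of_citedFactsR6 (hPub) (hPre) (hRat) (hMazur) : …Theses.EisensteinPrimes.BSDpOnCellC`
with `hPre`/`hRat`/`hMazur` EXACTLY as in p783713 and **`hPub` = telescope v21ʼs `stub_publishedFacts` text with EXACTLY TWO conjuncts removed — conjunct 9 of the inner block
(`∀ N W K, kolyvagin N W K`, Kolyvagin 1990 Thm. A) and conjunct 14 (`Castella2018Exceptional.thm210_thm211_bdpDisplay_pNew`) — every other conjunct token-identical and in the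
same nesting** (21 refereed named facts). PROOF = the CAS closure `…OfCitedFactsR5.bsdpOnCellC_of_citedFactsR5` (v21 minus Castella) fed the rebuilt 22-tuple whose kolyvagin
conjunct is the tree theorem `EisensteinPrimesBSDpOnCellCKolyvaginOfGZK.forall_kolyvagin_of_rank_eq_analyticRank h10 h6 h8` (p792104; from conjuncts 10, 6, 8). It is certifiable by
projection from v21ʼs hPub exactly like R4 (p792874) and R5, and it is THE closure a telescope v22 re-cut (`stub_publishedFacts` 23 → 21 under a fresh name) would cite — a LEAD act
under ONE NEW director word + the full W-79 trail, not this fileʼs.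
HONEST LABELS: both removals are REDUNDANCY removals on the TYPED register (Thm. 3.22 ⊇ Kolyvagin given GZ + modularity; LZZ18 is p-free as typed and replaces Castellaʼs `5 ≤ p`
value road — host watch h-W-CAS-1 on the print side); print debt behind Thm. 3.22 unchanged; by-name 27 → 25 / refereed 23 → 21 is the HOSTʼs booking on landed bytes.
HONEST FRAMING: CONDITIONAL result; discharges none of its hypotheses; closes no registered stub, no crux, no summit statement; BSD is proved for no curve by this file.
THEOREMS ONLY: no definition, no named fact, no instance, no `sorry`.
References (shape only): [cite: Kolyvagin1990, Thm. A] [cite: Darmon2004, Thm. 3.22] [cite: Castella2018Exceptional, Thm. 2.10 and Thm. 2.11] [cite: LiuZhangZhang2018, Thm. 1.5.1 and Thm. 1.5.3]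
-/


set_option autoImplicit false
set_option linter.dupNamespace false

noncomputable section

open scoped Classical MatrixGroups ModularForm

open CongruenceSubgroup WeierstrassCurve NumberField IsDedekindDomain Field PowerSeries
  Literature.NumberTheory.EllipticCurves Literature.NumberTheory.EllipticCurves.GreenbergSelmer
  Literature.NumberTheory.EllipticCurves.ModularForms Literature.NumberTheory.QuadraticFields
  Literature.NumberTheory.EllipticCurves.Rank1Residual
  Literature.NumberTheory.EllipticCurves.Rank1Residual.Typed
  Literature.NumberTheory.EllipticCurves.KrizLi2019
  Literature.NumberTheory.EllipticCurves.GreenbergVatsal2000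
  Literature.NumberTheory.EllipticCurves.Wuthrich2014
  Literature.NumberTheory.EllipticCurves.SteinWuthrich2013
  Literature.NumberTheory.EllipticCurves.Castella2018Exceptional
  Literature.NumberTheory.GaloisRepresentations Literature.NumberTheory.GaloisCohomology
  Literature.NumberTheory.Automorphic
  Summit.BirchSwinnertonDyer.Rank1Residual.X11b.AcSelmer
  Summit.BirchSwinnertonDyer.Rank1Residual.X11b.Halves
  Summit.BirchSwinnertonDyer.Rank1Residual.X11b
  Summit.BirchSwinnertonDyer.Rank1Residual Summit.BirchSwinnertonDyer.Rank1Residual.X1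
  Summit.BirchSwinnertonDyer.Rank1Residual.X2
open Literature.NumberTheory.EllipticCurves.KellerYin2024 (curveLocalLambda)


open Literature.NumberTheory.EllipticCurves.BigGaloisRep

namespace Summit.BirchSwinnertonDyer.BirchSwinnertonDyer.Theorems.EisensteinPrimesBSDpOnCellCOfCitedFactsR6

open Literature.NumberTheory.EllipticCurves.CastellaGrossiLeeSkinner2022 Literature.NumberTheory.EllipticCurves.Castella2018
  Literature.NumberTheory.IwasawaTheory Literature.NumberTheory.IwasawaTheory.Greenberg2016
  Literature.NumberTheory.IwasawaTheory.Greenberg2006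
  Summit.BirchSwinnertonDyer.Rank1Residual.X1.KellerYinMuLambdaSplit
open Literature.NumberTheory.EllipticCurves.KellerYin2024
open Summit.BirchSwinnertonDyer.BirchSwinnertonDyer.Theorems

/-- **Crux 4 `BSDpOnCellC` from 21 refereed facts (NO Kolyvagin Thm. A, NO Castella 2018 Thms. 2.10–2.11), Keller–Yin ×3, T-An-2ʳ and crux 3 (telescope v21 chain; cumulative conditional closure).** `hPub` = v21ʼs `stub_publishedFacts` text minus EXACTLY the `kolyvagin` conjunct and `thm210_thm211_bdpDisplay_pNew`; proof = R5 fed the rebuilt 22-tuple (kolyvagin from Thm. 3.22 + modularity + GZ, p792104). CONDITIONAL: nothing here discharges the hypotheses. [cite: Kolyvagin1990, Thm. A (shape only)] [cite: Castella2018Exceptional, Thm. 2.10 and Thm. 2.11 (shape only)] -/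
theorem bsdpOnCellC_of_citedFactsR6
    (hPub :
    (((lambdaMu_multiplicative_of_gvPar ∧ thm16_charIdeal_dvd_multiplicative_of_reducible ∧
    thm61_splitMultiplicative ∧ thm61_nonsplitMultiplicative ∧
    (∀ (W : WeierstrassCurve ℚ) [W.IsElliptic] [W.IsGloballyMinimal] (p : ℕ) [Fact p.Prime],
      greenberg_stevens (W := W) (p := p)) ∧
    exists_isNewformOf ∧
    hsieh2014_exists_anticyclotomicPAdicLFunction ∧
    (∀ (N : ℕ) [NeZero N] (W : WeierstrassCurve ℚ) (K : Type) [Field K] [NumberField K],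
      gross_zagier N W K) ∧
    rank_eq_analyticRank_of_analyticRank_le_one ∧ HoffsteinLuo1997_exists_twist_L_one_ne_zero ∧
    mazur_not_dvd_maninConstant_of_odd ∧ bsdRHS_eq_of_isIsogenous) ∧
    LiuZhangZhang2018.thm151_thm153_modularCurve_heegnerVector) ∧
    (prop125_characterGrSelmerDual_torsion_muZero_dim ∧
      cor126_residualCharacter_globalLift ∧ cor126_residualCharacter_localSurjective ∧
      thm212_exists_isKatzLFunction ∧
      Literature.NumberTheory.EllipticCurves.Castella2018.cas20_thm211_memberForms_sigmaFrames_congr)) ∧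
      Literature.NumberTheory.EllipticCurves.BCGKPST2020.thm331_rubin_exists_katzMeasure₂_pseudoIso_span_eq ∧
      Literature.NumberTheory.EllipticCurves.DeShalit1987.thmII64_katzMeasure₂_functionalEquation ∧
      Literature.NumberTheory.EllipticCurves.Hida2010MuInvariant.thmI_mu_katzBranch_reflect_eq_zero)
    (hPre :
    Literature.NumberTheory.EllipticCurves.KellerYin2024.thm308_imc2_hidaMember_dvd_OPEN ∧
      Literature.NumberTheory.EllipticCurves.KellerYin2024.thm222_anacong_hidaMember_sigma_mu_OPEN ∧
      Literature.NumberTheory.EllipticCurves.KellerYin2024.thm222_anacong_hidaMember_sigma_lambda_OPEN)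
    (hRat : Literature.NumberTheory.EllipticCurves.hida1986_castella2020_exists_rationalMembers_on_pNewBranchChart)
    (hMazur :
    Summit.BirchSwinnertonDyer.BirchSwinnertonDyer.Theses.EisensteinPrimes.MazurMCOnCellB) :
    Summit.BirchSwinnertonDyer.BirchSwinnertonDyer.Theses.EisensteinPrimes.BSDpOnCellC := by
  obtain ⟨⟨⟨⟨h1, h2, h3, h4, h5, h6, h7, h8, h10, h11, h12, h13⟩, h15⟩, hB⟩, h21, h22, h23⟩ := hPub
  exact EisensteinPrimesBSDpOnCellCOfCitedFactsR5.bsdpOnCellC_of_citedFactsR5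
    ⟨⟨⟨⟨h1, h2, h3, h4, h5, h6, h7, h8,
      EisensteinPrimesBSDpOnCellCKolyvaginOfGZK.forall_kolyvagin_of_rank_eq_analyticRank h10 h6 h8,
      h10, h11, h12, h13⟩, h15⟩, hB⟩, h21, h22, h23⟩ hPre hRat hMazur

end Summit.BirchSwinnertonDyer.BirchSwinnertonDyer.Theorems.EisensteinPrimesBSDpOnCellCOfCitedFactsR6

end
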